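import Literature.NumberTheory.LFunctions.DirichletLTruncationCertificatesOdd
import HarnessLib

/-!
# Truncation certificates with the MEAN of the partial sums (the class-number drift made explicit):
# `L(σ, χ) > 0` on `[1/2, 1]` for odd real characters with a small truncation, evaluated in the kernel

Topic `Literature/NumberTheory/LFunctions`; namespace `Literature.NumberTheory.LFunctions.LTruncationCert`
(continues `DirichletLTruncationCertificates.lean`, `…Odd.lean`).  Small computable definitions (`sumsMean`,
`certMeanOK`) and THEOREMS; no named fact, no `sorry`.  Cell `parity-realchar`.

## The method

For an odd real primitive character `χ` mod `q > 4` the partial sums `S(N) = ∑_{n ≤ N} χ(n)` have the positive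
MEAN `h̄ = U(q)/q = −(1/q)∑_{n ≤ q} nχ(n) = h(−q)` over a period (`U(N) = ∑_{K ≤ N} S(K)`).  Writing
`S = h̄ + S₀` with `S₀` of mean zero, the second Abel summation of the companion files gives, for `χ ≠ χ₀`,
`K ≥ 1` periods and real `σ > 0`,
  `ℜ L(σ, χ) ≥ ∑_{n ≤ Kq} χ(n) n^{−σ} + h̄·(Kq+1)^{−σ} − B₀·((Kq+1)^{−σ} − (Kq+2)^{−σ})`,
where `−B₀ ≤ U(N) − N h̄` for `N < q` (`re_LFunction_ge_truncation_mean`).  The drift term `h̄ (Kq+1)^{−σ}`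
(`≈ h(−q)/√q` at `σ = 1/2`, one period) is exactly what the one-period truncation misses for the conductors
with a small central value (`q = 708, 1012`: `∑_{n ≤ q} χ(n)/√n < 0` while `h(−q) = 4`), so that `K = 1` and
16 cells suffice throughout.  Kernel checker **`certMeanOK v q K J P`** (cells by `loop`, roots by `rootEnc` of
the companion file; the drift term enters each cell through the enclosure of `(Kq+1)^{−s_{j+1}}`), soundness
**`lfunction_ne_zero_of_certMeanOK`**, wrappers `good_odd_of_odd_mean` / `_four_mean` / `_eight_mean`.
[cite: Chua2005RealZeros, Theorem 2.2, §2.2 ALGO 1]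

## References

* K. S. Chua, *Real zeros of Dedekind zeta functions of real quadratic fields*, Math. Comp. 74 (2005)
  1457–1470, §2. [Chua2005RealZeros]
* M. Watkins, *Real zeros of real odd Dirichlet L-functions*, Math. Comp. 73 (2004) 415–423. [Watkins2004RealZeros]
* H. L. Montgomery, R. C. Vaughan, *Multiplicative Number Theory I*, CUP 2007, §1.3, §4.3, §10.1.
  [MontgomeryVaughan2007]
-/

noncomputable section

namespace Literature.NumberTheory.LFunctions

namespace LTruncationCert

open Finset Complex Filter Topology FeketePolyaKernel PrimitiveQuadratic LTruncation DirichletAbel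

variable {q : ℕ} [NeZero q] (χ : DirichletCharacter ℂ q)

/-- `S(N + Kq) = S(N)` (`χ ≠ χ₀`; private copy). [cite: MontgomeryVaughan2007, §4.3 eq. (4.23)] -/
private theorem partialSum_add_mul_level' (hχ : χ ≠ 1) (K N : ℕ) :
    partialSum χ (N + K * q) = partialSum χ N := by
  induction K with
  | zero => simp
  | succ K ih => rw [show N + (K + 1) * q = (N + K * q) + q by ring, partialSum_add_level χ hχ, ih]

omit [NeZero q] in
/-- The Abel terms at a real point (private copy). [cite: MontgomeryVaughan2007, §1.3 Thm. 1.3] -/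
private theorem term_ofReal'' (n : ℕ) (σ : ℝ) :
    term χ n (σ : ℂ) = partialSum χ (n + 1) *
      ((((n + 1 : ℕ) : ℝ) ^ (-σ) - ((n + 1 + 1 : ℕ) : ℝ) ^ (-σ) : ℝ) : ℂ) := by
  simp only [term]
  rw [show ((n + 1 : ℕ) : ℂ) = (((n + 1 : ℕ) : ℝ) : ℂ) by push_cast; rfl,
    show ((n + 1 + 1 : ℕ) : ℂ) = (((n + 1 + 1 : ℕ) : ℝ) : ℂ) by push_cast; rfl,
    show -(σ : ℂ) = ((-σ : ℝ) : ℂ) by push_cast; rfl,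
    ← Complex.ofReal_cpow (by positivity), ← Complex.ofReal_cpow (by positivity), ← Complex.ofReal_sub]

/-- With `h̄ = ℜU(q)/q`, the centred second sums `ℜU(N) − N h̄` are `q`-periodic; hence a lower bound over one
period holds everywhere. [cite: Chua2005RealZeros, Theorem 2.2] -/
theorem re_sum_partialSum_sub_ge (hχ : χ ≠ 1) {B : ℝ}
    (hU : ∀ N, N < q → -B ≤ (∑ k ∈ range N, partialSum χ (k + 1)).re -
      N * ((∑ k ∈ range q, partialSum χ (k + 1)).re / q)) (N : ℕ) :
    -B ≤ (∑ k ∈ range N, partialSum χ (k + 1)).re -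
      N * ((∑ k ∈ range q, partialSum χ (k + 1)).re / q) := by
  have hq0 : (q : ℝ) ≠ 0 := by exact_mod_cast NeZero.ne q
  induction N using Nat.strong_induction_on with
  | _ N ih =>
    rcases lt_or_ge N q with hN | hN
    · exact hU N hN
    · obtain ⟨k, rfl⟩ := Nat.exists_eq_add_of_le hN
      have hsplit : ∑ i ∈ range (q + k), partialSum χ (i + 1) =
          ∑ i ∈ range q, partialSum χ (i + 1) + ∑ i ∈ range k, partialSum χ (i + 1) := by
        rw [Finset.sum_range_add]
        congr 1
        refine Finset.sum_congr rfl fun i _ ↦ ?_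
        rw [show q + i + 1 = (i + 1) + q by ring, partialSum_add_level χ hχ]
      rw [hsplit, Complex.add_re]
      have := ih k (by have := NeZero.pos q; omega)
      have e : ((q + k : ℕ) : ℝ) * ((∑ k ∈ range q, partialSum χ (k + 1)).re / q) =
          (∑ k ∈ range q, partialSum χ (k + 1)).re + (k : ℝ) * ((∑ k ∈ range q, partialSum χ (k + 1)).re / q) := by
        push_cast; field_simp
      rw [e]; linarith

/-- **The tail with the mean made explicit, `K` periods.** For `χ ≠ χ₀`, `h̄ = ℜU(q)/q`,
`ℜU(N) − N h̄ ≥ −B` (`N < q`), real `σ > 0`: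
`ℜ ∑_{n > Kq} S(n)(n^{−σ} − (n+1)^{−σ}) ≥ h̄ (Kq+1)^{−σ} − B((Kq+1)^{−σ} − (Kq+2)^{−σ})`.
[cite: Chua2005RealZeros, Theorem 2.2] -/
theorem re_tsum_term_tail_ge_mean (hχ : χ ≠ 1) {B : ℝ}
    (hU : ∀ N, N < q → -B ≤ (∑ k ∈ range N, partialSum χ (k + 1)).re -
      N * ((∑ k ∈ range q, partialSum χ (k + 1)).re / q)) {σ : ℝ} (hσ : 0 < σ) (K : ℕ) :
    ((∑ k ∈ range q, partialSum χ (k + 1)).re / q) * ((K * q + 1 : ℕ) : ℝ) ^ (-σ) -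
        B * (((K * q + 1 : ℕ) : ℝ) ^ (-σ) - ((K * q + 1 + 1 : ℕ) : ℝ) ^ (-σ)) ≤
      (∑' k : ℕ, term χ (k + K * q) (σ : ℂ)).re := by
  set hbar : ℝ := (∑ k ∈ range q, partialSum χ (k + 1)).re / q with hhbar
  have hs : 0 < (σ : ℂ).re := by simpa using hσ
  have hsum : Summable fun k : ℕ ↦ term χ (k + K * q) (σ : ℂ) :=
    (summable_nat_add_iff (K * q)).mpr (summable_term χ hχ hs)
  have ht : Tendsto (fun n ↦ (∑ i ∈ range n, term χ (i + K * q) (σ : ℂ)).re) atTop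
      (𝓝 (∑' k : ℕ, term χ (k + K * q) (σ : ℂ)).re) :=
    (Complex.continuous_re.tendsto _).comp hsum.tendsto_sum_tsum_nat
  -- the weights `w_k = W_k − W_{k+1}`, `W_k = (Kq+1+k)^{-σ}`
  set W : ℕ → ℝ := fun k ↦ ((K * q + 1 + k : ℕ) : ℝ) ^ (-σ) with hW
  have hWlim : Tendsto W atTop (𝓝 0) := by
    have h1 : Tendsto (fun k : ℕ ↦ ((K * q + 1 + k : ℕ) : ℝ)) atTop atTop := by
      have h := (Filter.tendsto_add_atTop_iff_nat (f := fun m : ℕ ↦ (m : ℝ)) (K * q + 1)).mpr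
        tendsto_natCast_atTop_atTop
      refine h.congr fun k ↦ ?_
      simp only [show k + (K * q + 1) = K * q + 1 + k by ring]
    exact (tendsto_rpow_neg_atTop hσ).comp h1
  -- lower bound for every partial sum
  have hlow : ∀ L, hbar * (W 0 - W L) - B * (W 0 - W 1) ≤
      (∑ i ∈ range L, term χ (i + K * q) (σ : ℂ)).re := by
    intro L
    rw [Complex.re_sum]
    have hterm : ∀ k, (term χ (k + K * q) (σ : ℂ)).re =
        (partialSum χ (k + 1)).re * (W k - W (k + 1)) := fun k ↦ by
      rw [term_ofReal'', Complex.re_mul_ofReal,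
        show partialSum χ (k + K * q + 1) = partialSum χ (k + 1) by
          rw [show k + K * q + 1 = (k + 1) + K * q by ring, partialSum_add_mul_level' χ hχ], hW]
      simp only [show K * q + 1 + k = k + K * q + 1 by ring, show K * q + 1 + (k + 1) = k + K * q + 1 + 1 by ring]
    simp only [hterm]
    -- split `ℜS(k+1) = hbar + b_k`
    have hsplit : ∑ i ∈ range L, (partialSum χ (i + 1)).re * (W i - W (i + 1)) =
        hbar * ∑ i ∈ range L, (W i - W (i + 1)) +
          ∑ i ∈ range L, ((partialSum χ (i + 1)).re - hbar) * (W i - W (i + 1)) := by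
      rw [Finset.mul_sum, ← Finset.sum_add_distrib]
      refine Finset.sum_congr rfl fun i _ ↦ by ring
    rw [hsplit, Finset.sum_range_sub' W L]
    have hw0 : ∀ k, 0 ≤ W k - W (k + 1) := fun k ↦ by
      simp only [hW]
      have : ((K * q + 1 + (k + 1) : ℕ) : ℝ) ^ (-σ) ≤ ((K * q + 1 + k : ℕ) : ℝ) ^ (-σ) :=
        Real.rpow_le_rpow_of_nonpos (by positivity) (by push_cast; linarith) (by linarith)
      linarith
    have hw : ∀ k, W (k + 1) - W (k + 1 + 1) ≤ W k - W (k + 1) := fun k ↦ by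
      have h2 := Literature.Barriers.RiemannHypothesis.two_mul_rpow_neg_lt (k + K * q) hσ
      simp only [hW, show K * q + 1 + k = k + K * q + 1 by ring, show K * q + 1 + (k + 1) = k + K * q + 1 + 1 by ring,
        show K * q + 1 + (k + 1 + 1) = k + K * q + 1 + 1 + 1 by ring]
      linarith
    have hA : ∀ N, N ≤ L → -B ≤ ∑ k ∈ range N, ((partialSum χ (k + 1)).re - hbar) := fun N _ ↦ by
      rw [Finset.sum_sub_distrib, Finset.sum_const, Finset.card_range, nsmul_eq_mul, ← Complex.re_sum]
      exact re_sum_partialSum_sub_ge χ hχ hU N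
    have h := sum_mul_ge_of_antitone (fun k ↦ (partialSum χ (k + 1)).re - hbar) (fun k ↦ W k - W (k + 1))
      (B := B) L hA hw0 hw
    linarith
  -- pass to the limit
  have hlim : Tendsto (fun L ↦ hbar * (W 0 - W L) - B * (W 0 - W 1)) atTop
      (𝓝 (hbar * (W 0 - 0) - B * (W 0 - W 1))) :=
    ((tendsto_const_nhds.sub hWlim).const_mul hbar).sub tendsto_const_nhds
  have hfinal := le_of_tendsto_of_tendsto' hlim ht hlow
  have e0 : W 0 = ((K * q + 1 : ℕ) : ℝ) ^ (-σ) := by simp [hW]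
  have e1 : W 1 = ((K * q + 1 + 1 : ℕ) : ℝ) ^ (-σ) := by simp [hW]
  rw [e0, e1, sub_zero] at hfinal
  exact hfinal

/-- **The truncation bound with the mean.** For `χ ≠ χ₀` mod `q`, `h̄ = ℜU(q)/q`, `ℜU(N) − N h̄ ≥ −B`
(`N < q`), real `σ > 0` and `K` periods:
`ℜ L(σ, χ) ≥ ∑_{n ≤ Kq} ℜχ(n) n^{−σ} + h̄ (Kq+1)^{−σ} − B((Kq+1)^{−σ} − (Kq+2)^{−σ})`.
[cite: Chua2005RealZeros, Theorem 2.2] -/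
theorem re_LFunction_ge_truncation_mean (hχ : χ ≠ 1) {B : ℝ}
    (hU : ∀ N, N < q → -B ≤ (∑ k ∈ range N, partialSum χ (k + 1)).re -
      N * ((∑ k ∈ range q, partialSum χ (k + 1)).re / q)) {σ : ℝ} (hσ : 0 < σ) (K : ℕ) :
    (∑ n ∈ range (K * q), (χ ((n + 1 : ℕ) : ZMod q)).re * ((n + 1 : ℕ) : ℝ) ^ (-σ)) +
        ((∑ k ∈ range q, partialSum χ (k + 1)).re / q) * ((K * q + 1 : ℕ) : ℝ) ^ (-σ) -
        B * (((K * q + 1 : ℕ) : ℝ) ^ (-σ) - ((K * q + 1 + 1 : ℕ) : ℝ) ^ (-σ)) ≤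
      (χ.LFunction (σ : ℂ)).re := by
  have hs : 0 < (σ : ℂ).re := by simpa using hσ
  have hsum := summable_term χ hχ hs
  rw [LFunction_eq_abelSum χ hχ hs, abelSum, ← hsum.sum_add_tsum_nat_add (K * q), Complex.add_re]
  have hhead : (∑ n ∈ range (K * q), term χ n (σ : ℂ)).re =
      ∑ n ∈ range (K * q), (χ ((n + 1 : ℕ) : ZMod q)).re * ((n + 1 : ℕ) : ℝ) ^ (-σ) := by
    have h := sum_apply_mul_cpow_eq χ (σ : ℂ) (K * q)
    have hq : partialSum χ (K * q) = 0 := by simpa using partialSum_add_mul_level' χ hχ K 0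
    rw [hq, zero_mul, zero_add] at h
    rw [← h, Complex.re_sum]
    refine Finset.sum_congr rfl fun n _ ↦ ?_
    rw [show ((n + 1 : ℕ) : ℂ) = (((n + 1 : ℕ) : ℝ) : ℂ) by push_cast; rfl,
      show -(σ : ℂ) = ((-σ : ℝ) : ℂ) by push_cast; rfl, ← Complex.ofReal_cpow (by positivity),
      Complex.re_mul_ofReal]
  rw [hhead]
  have htail := re_tsum_term_tail_ge_mean χ hχ hU hσ K
  linarith

/-- Tail weight at `σ ≥ 1/2` (private copy): `m ≥ 8`, `σ ≥ 1/2`, `0 < r`, `r² ≤ m` ⇒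
`m^{−σ} − (m+1)^{−σ} ≤ 1/(2rm)`. [cite: Chua2005RealZeros, Theorem 2.2] -/
private theorem wt_le_of_half_le'' {σ : ℝ} (hσ : 1 / 2 ≤ σ) {m : ℕ} (hm : 8 ≤ m) {r : ℕ} (hr : 0 < r)
    (hrm : r * r ≤ m) : (m : ℝ) ^ (-σ) - ((m + 1 : ℕ) : ℝ) ^ (-σ) ≤ 1 / (2 * r * m) := by
  have hm0 : (0 : ℝ) < m := by exact_mod_cast (show 0 < m by omega)
  have hr0 : (0 : ℝ) < r := by exact_mod_cast hr
  have hm1 : (0 : ℝ) < (m : ℝ) + 1 := by linarith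
  have hcast : ((m + 1 : ℕ) : ℝ) = (m : ℝ) + 1 := by push_cast; ring
  have h1 : (m : ℝ) ^ (-σ) - ((m + 1 : ℕ) : ℝ) ^ (-σ) ≤ (m : ℝ) ^ (-σ) * (σ / m) := by
    rw [hcast]
    have hsplit : ((m : ℝ) + 1) ^ (-σ) = (m : ℝ) ^ (-σ) * (((m : ℝ) + 1) / m) ^ (-σ) := by
      rw [Real.div_rpow hm1.le hm0.le, mul_div_assoc', mul_comm, ← mul_div_assoc', div_self
        (Real.rpow_pos_of_pos hm0 _).ne', mul_one]
    have hlog : Real.log (((m : ℝ) + 1) / m) ≤ 1 / m := by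
      have h := Real.log_le_sub_one_of_pos (show (0 : ℝ) < ((m : ℝ) + 1) / m by positivity)
      have h2 : ((m : ℝ) + 1) / m - 1 = 1 / m := by field_simp; ring
      linarith
    have hexp : 1 - σ / m ≤ (((m : ℝ) + 1) / m) ^ (-σ) := by
      rw [Real.rpow_def_of_pos (by positivity)]
      have h3 := Real.add_one_le_exp (Real.log (((m : ℝ) + 1) / m) * -σ)
      have h4 : Real.log (((m : ℝ) + 1) / m) * σ ≤ 1 / m * σ :=
        mul_le_mul_of_nonneg_right hlog (by linarith)
      have h5 : 1 / (m : ℝ) * σ = σ / m := by ring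
      linarith
    have hpos : 0 < (m : ℝ) ^ (-σ) := Real.rpow_pos_of_pos hm0 _
    rw [hsplit]
    nlinarith [mul_le_mul_of_nonneg_left hexp hpos.le]
  have hlog : 2 ≤ Real.log m := by
    have h8 : (8 : ℝ) ≤ m := by exact_mod_cast hm
    have he : Real.exp 2 ≤ 8 := by
      have := Real.exp_one_lt_d9
      have h2 : Real.exp 2 = Real.exp 1 * Real.exp 1 := by rw [← Real.exp_add]; norm_num
      nlinarith [Real.exp_pos 1]
    calc (2 : ℝ) = Real.log (Real.exp 2) := (Real.log_exp 2).symm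
      _ ≤ Real.log m := Real.log_le_log (Real.exp_pos 2) (he.trans h8)
  have h2 : σ * (m : ℝ) ^ (-σ) ≤ 1 / 2 * (m : ℝ) ^ (-(1 / 2 : ℝ)) := by
    have hsplit : (m : ℝ) ^ (-σ) = (m : ℝ) ^ (-(1 / 2 : ℝ)) * Real.exp (-(σ - 1 / 2) * Real.log m) := by
      rw [Real.rpow_def_of_pos hm0, Real.rpow_def_of_pos hm0, ← Real.exp_add]
      congr 1; ring
    have hexp : Real.exp (-(σ - 1 / 2) * Real.log m) ≤ Real.exp (-(σ - 1 / 2) * 2) := by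
      rw [Real.exp_le_exp]; nlinarith
    have hkey : σ * Real.exp (-(σ - 1 / 2) * 2) ≤ 1 / 2 := by
      have h3 := Real.add_one_le_exp (2 * σ - 1)
      have h4 : Real.exp (-(σ - 1 / 2) * 2) * Real.exp (2 * σ - 1) = 1 := by
        rw [← Real.exp_add]; norm_num; ring_nf
      have h5 : 0 < Real.exp (-(σ - 1 / 2) * 2) := Real.exp_pos _
      nlinarith
    have hpos : 0 < (m : ℝ) ^ (-(1 / 2 : ℝ)) := Real.rpow_pos_of_pos hm0 _
    rw [hsplit]
    have hσ0 : 0 ≤ σ := by linarith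
    calc σ * ((m : ℝ) ^ (-(1 / 2 : ℝ)) * Real.exp (-(σ - 1 / 2) * Real.log m))
        = (m : ℝ) ^ (-(1 / 2 : ℝ)) * (σ * Real.exp (-(σ - 1 / 2) * Real.log m)) := by ring
      _ ≤ (m : ℝ) ^ (-(1 / 2 : ℝ)) * (σ * Real.exp (-(σ - 1 / 2) * 2)) :=
          mul_le_mul_of_nonneg_left (mul_le_mul_of_nonneg_left hexp hσ0) hpos.le
      _ ≤ (m : ℝ) ^ (-(1 / 2 : ℝ)) * (1 / 2) := mul_le_mul_of_nonneg_left hkey hpos.le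
      _ = 1 / 2 * (m : ℝ) ^ (-(1 / 2 : ℝ)) := by ring
  have h3 : (m : ℝ) ^ (-(1 / 2 : ℝ)) ≤ 1 / r := by
    have hsq : (r : ℝ) ≤ Real.sqrt m := by
      rw [Real.le_sqrt hr0.le hm0.le]; exact_mod_cast (by simpa [pow_two] using hrm)
    rw [Real.rpow_neg hm0.le, ← Real.sqrt_eq_rpow, one_div]
    exact inv_anti₀ hr0 hsq
  calc (m : ℝ) ^ (-σ) - ((m + 1 : ℕ) : ℝ) ^ (-σ) ≤ (m : ℝ) ^ (-σ) * (σ / m) := h1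
    _ = σ * (m : ℝ) ^ (-σ) / m := by ring
    _ ≤ 1 / 2 * (m : ℝ) ^ (-(1 / 2 : ℝ)) / m := div_le_div_of_nonneg_right h2 hm0.le
    _ ≤ 1 / 2 * (1 / r) / m :=
        div_le_div_of_nonneg_right (mul_le_mul_of_nonneg_left h3 (by norm_num)) hm0.le
    _ = 1 / (2 * r * m) := by field_simp

/-- **Assembly with the mean.** `χ` primitive mod `q ≥ 7`, `χ ≠ χ₀`, `K ≥ 1` periods, `h̄ = ℜU(q)/q`,
`ℜU(N) − N h̄ ≥ −B` (`N < q`, `B ≥ 0`), `0 < r`, `r² ≤ Kq + 1`, and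
`P_K(σ) + h̄ (Kq+1)^{−σ} > B/(2r(Kq+1))` on `[1/2, 1]` ⇒ `L(σ, χ) ≠ 0` for `σ ∈ (0, 1)`. [cite: Chua2005RealZeros, §2.2 ALGO 1] -/
theorem lfunction_ne_zero_of_truncation_mean (hprim : χ.IsPrimitive) (hχ : χ ≠ 1)
    (hq7 : 7 ≤ q) {K : ℕ} (hK : 1 ≤ K) {B : ℝ} (hB : 0 ≤ B)
    (hU : ∀ N, N < q → -B ≤ (∑ k ∈ range N, partialSum χ (k + 1)).re -
      N * ((∑ k ∈ range q, partialSum χ (k + 1)).re / q))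
    {r : ℕ} (hr : 0 < r) (hrq : r * r ≤ K * q + 1)
    (hP : ∀ σ : ℝ, 1 / 2 ≤ σ → σ ≤ 1 → B / (2 * r * (K * q + 1 : ℕ)) <
      (∑ n ∈ range (K * q), (χ ((n + 1 : ℕ) : ZMod q)).re * ((n + 1 : ℕ) : ℝ) ^ (-σ)) +
        ((∑ k ∈ range q, partialSum χ (k + 1)).re / q) * ((K * q + 1 : ℕ) : ℝ) ^ (-σ)) :
    ∀ σ : ℝ, 0 < σ → σ < 1 → χ.LFunction (σ : ℂ) ≠ 0 := by
  have hKq : 7 ≤ K * q := le_trans hq7 (Nat.le_mul_of_pos_left q hK)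
  refine lfunction_ne_zero_of_re_pos χ hprim (by omega) fun σ hσ hσ1 ↦ ?_
  have h1 := re_LFunction_ge_truncation_mean χ hχ hU (σ := σ) (by linarith) K
  have h2 : ((K * q + 1 : ℕ) : ℝ) ^ (-σ) - ((K * q + 1 + 1 : ℕ) : ℝ) ^ (-σ) ≤
      1 / (2 * r * (K * q + 1 : ℕ)) := wt_le_of_half_le'' hσ (by omega) hr hrq
  have h3 : B * (((K * q + 1 : ℕ) : ℝ) ^ (-σ) - ((K * q + 1 + 1 : ℕ) : ℝ) ^ (-σ)) ≤
      B / (2 * r * (K * q + 1 : ℕ)) := by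
    calc B * (((K * q + 1 : ℕ) : ℝ) ^ (-σ) - ((K * q + 1 + 1 : ℕ) : ℝ) ^ (-σ))
        ≤ B * (1 / (2 * r * (K * q + 1 : ℕ))) := mul_le_mul_of_nonneg_left h2 hB
      _ = B / (2 * r * (K * q + 1 : ℕ)) := by ring
  linarith [hP σ hσ hσ1]

end LTruncationCert

end Literature.NumberTheory.LFunctions

end

/-! ## The kernel checker with the mean and its soundness -/

namespace Literature.NumberTheory.LFunctions

namespace LTruncationCert

open Finset FeketePolyaKernel PrimitiveQuadratic LTruncation DirichletAbel

/-- Second pass over one period: with `Uq = U(q)` known, `max_N (N·Uq − q·U(N))⁺` (`q` times the negative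
part of the centred second sums). [folklore] -/
def sumsMean (v : ℕ → ℤ) (q : ℕ) (Uq : ℤ) : ℕ → ℕ → ℤ → ℤ → ℕ → ℕ
  | 0, _, _, _, B => B
  | fuel + 1, t, s, u, B =>
    sumsMean v q Uq fuel (t + 1) (s + v (t + 1)) (u + (s + v (t + 1)))
      (max B ((t + 1 : ℕ) * Uq - (q : ℤ) * (u + (s + v (t + 1)))).toNat)

/-- **The certificate with the mean.** `certMeanOK v q K J P`: truncation after `K` periods (`N₀ = Kq`), `J`
cells covering `[1/2, 1]`, precision `2^{−P}`; with `Uq = U(q) ≥ 0`, `Bn = max_N (N·Uq − q·U(N))⁺`,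
`ρ ≤ 2^P N₀^{−1/(2J)}`, `r² ≤ N₀ + 1`, `e_j ≤ 2^P (N₀+1)^{−s_{j+1}}`, every cell must satisfy
`2J·4^P·Bn + 2q·r·(N₀+1)·d_j < 2·2J·q·r·(N₀+1)·t_j + 2·2J·r·(N₀+1)·2^P·Uq·e_j` with `t_j = a_j ρ` if `a_j ≥ 0`
and `t_j = a_j 2^P` if `a_j < 0` (the truncation may be negative where the drift term carries the cell).
[cite: Chua2005RealZeros, §2.2 ALGO 1] -/
def certMeanOK (v : ℕ → ℤ) (q K J P : ℕ) : Bool :=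
  let N₀ := K * q
  let Uq := (sums v q 0 0 0 0).2.1
  let Bn := sumsMean v q Uq q 0 0 0 0
  let cells := loop v N₀ J P N₀ 0 (List.replicate J ((0 : ℤ), (0 : ℕ)))
  let es := (List.range J).map (fun j ↦ (enc (N₀ + 1) J P (J + j + 1)).1)
  let ρ := (rootEnc N₀ (2 * J) P).1
  let r := isqrtSucc N₀
  decide (7 ≤ q) && decide (1 ≤ K) && decide (0 < J) && decide (0 ≤ Uq) && decide (0 < r) &&
    (cells.zip es).all (fun ce ↦
      decide (((2 * J * (2 ^ P * 2 ^ P) * Bn + 2 * q * r * (N₀ + 1) * ce.1.2 : ℕ) : ℤ) <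
        (2 * (2 * J) * q * r * (N₀ + 1) : ℕ) * (if 0 ≤ ce.1.1 then ce.1.1 * ρ else ce.1.1 * 2 ^ P) +
          ((2 * (2 * J) * r * (N₀ + 1) * 2 ^ P : ℕ) : ℤ) * Uq * ce.2))

section Soundness

variable (v : ℕ → ℤ) (q : ℕ)

/-- Invariant of `sumsMean`. [cite: Chua2005RealZeros, Theorem 2.2] -/
theorem sumsMean_spec (Uq : ℤ) : ∀ (fuel t B : ℕ),
    (∀ j, j ≤ t → ((j : ℤ) * Uq - (q : ℤ) * Uv v j).toNat ≤ B) →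
      ∀ j, j ≤ t + fuel → ((j : ℤ) * Uq - (q : ℤ) * Uv v j).toNat ≤ sumsMean v q Uq fuel t (Sv v t) (Uv v t) B := by
  intro fuel
  induction fuel with
  | zero => intro t B hB j hj; simpa [sumsMean] using hB j (by omega)
  | succ fuel ih =>
    intro t B hB
    have h1 : Sv v t + v (t + 1) = Sv v (t + 1) := by simp [Sv]
    have h2 : Uv v t + (Sv v t + v (t + 1)) = Uv v (t + 1) := by simp [Uv, Sv]
    simp only [sumsMean]
    rw [h2, h1]
    have hB' : ∀ j, j ≤ t + 1 → ((j : ℤ) * Uq - (q : ℤ) * Uv v j).toNat ≤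
        max B (((t + 1 : ℕ) : ℤ) * Uq - (q : ℤ) * Uv v (t + 1)).toNat := by
      intro j hj
      rcases Nat.lt_or_ge j (t + 1) with hlt | hge
      · exact (hB j (by omega)).trans (le_max_left _ _)
      · rw [show j = t + 1 by omega]; exact le_max_right _ _
    intro j hj
    exact ih (t + 1) _ hB' j (by omega)

variable {v} {q} [NeZero q] {χ : DirichletCharacter ℂ q}

omit [NeZero q] in
/-- Values in `{0, 1, −1}` (private copy). [folklore] -/
private theorem val_trichotomy'' (hquad : χ.IsQuadratic) (hv : ∀ n : ℕ, (χ (n : ZMod q)).re = v n)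
    (n : ℕ) : v n = 0 ∨ v n = 1 ∨ v n = -1 := by
  have h := hv n
  rcases hquad (n : ZMod q) with h0 | h1 | h2
  · rw [h0, Complex.zero_re] at h; left; exact_mod_cast h.symm
  · rw [h1, Complex.one_re] at h; right; left; exact_mod_cast h.symm
  · rw [h2, Complex.neg_re, Complex.one_re] at h; right; right; exact_mod_cast h.symm

omit [NeZero q] in
/-- `ℜ S(N) = Sv N` (private copy). [folklore] -/
private theorem re_partialSum_eq_Sv' (hv : ∀ n : ℕ, (χ (n : ZMod q)).re = v n) :
    ∀ N : ℕ, (partialSum χ N).re = (Sv v N : ℝ) := by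
  intro N
  induction N with
  | zero => simp [Sv]
  | succ N ih => rw [partialSum_succ, Complex.add_re, ih, hv, Sv]; push_cast; ring

omit [NeZero q] in
/-- `ℜ U(N) = Uv N` (private copy). [folklore] -/
private theorem re_sum_partialSum_eq_Uv' (hv : ∀ n : ℕ, (χ (n : ZMod q)).re = v n) :
    ∀ N : ℕ, (∑ k ∈ range N, partialSum χ (k + 1)).re = (Uv v N : ℝ) := by
  intro N
  induction N with
  | zero => simp [Uv]
  | succ N ih =>
    rw [Finset.sum_range_succ, Complex.add_re, ih, re_partialSum_eq_Sv' hv, Uv]; push_cast; ring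

/-- The bisection invariant (private copy). [folklore] -/
private theorem bisect_spec'' (pred : ℕ → Bool) : ∀ (fuel xl xh : ℕ), pred xl = true → pred xh = false →
    pred (bisect pred fuel xl xh).1 = true ∧ pred (bisect pred fuel xl xh).2 = false := by
  intro fuel
  induction fuel with
  | zero => intro xl xh h1 h2; exact ⟨h1, h2⟩
  | succ fuel ih =>
    intro xl xh h1 h2
    simp only [bisect]
    split_ifs with hlt hmid
    · exact ih _ _ hmid h2
    · exact ih _ _ h1 (by simpa using hmid)
    · exact ⟨h1, h2⟩

omit [NeZero q] in
/-- `sums v q 0 0 0 0` returns `U(q)` in its second component. [cite: Chua2005RealZeros, Theorem 2.2] -/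
private theorem sums_snd_eq : (sums v q 0 0 0 0).2.1 = Uv v q := by
  have := (sums_spec v q 0 0 (fun j hj ↦ by rw [show j = 0 by omega]; simp [Uv])).2.1
  simpa [Sv, Uv] using this

/-- **Soundness of the certificate with the mean.** For a primitive quadratic `χ` mod `q` with `ℜχ(n) = v(n)`:
`certMeanOK v q K J P = true ⇒ L(σ, χ) ≠ 0` for every `σ ∈ (0, 1)`. [cite: Chua2005RealZeros, §2.2 ALGO 1] -/
theorem lfunction_ne_zero_of_certMeanOK (hprim : χ.IsPrimitive) (hquad : χ.IsQuadratic)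
    (hv : ∀ n : ℕ, (χ (n : ZMod q)).re = v n) {K J P : ℕ} (hcert : certMeanOK v q K J P = true) :
    ∀ σ : ℝ, 0 < σ → σ < 1 → χ.LFunction (σ : ℂ) ≠ 0 := by
  simp only [certMeanOK, Bool.and_eq_true, decide_eq_true_eq, List.all_eq_true] at hcert
  obtain ⟨⟨⟨⟨⟨hq7, hK⟩, hJ⟩, hU0⟩, hr⟩, hcells⟩ := hcert
  have hJ1 : 1 ≤ J := hJ
  have hv3 := val_trichotomy'' hquad hv
  set N₀ : ℕ := K * q with hN₀
  have hN₀7 : 7 ≤ N₀ := le_trans hq7 (Nat.le_mul_of_pos_left q hK)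
  have hq0 : (0 : ℝ) < q := by exact_mod_cast (show 0 < q by omega)
  -- `Uq = U(q) ≥ 0`, `hbar = Uq/q`
  rw [sums_snd_eq] at hU0 hcells
  set Uq : ℤ := Uv v q with hUq
  set hbar : ℝ := (∑ k ∈ range q, partialSum χ (k + 1)).re / q with hhbar
  have hhbarUq : hbar = (Uq : ℝ) / q := by rw [hhbar, re_sum_partialSum_eq_Uv' hv]
  have hhbar0 : 0 ≤ hbar := by rw [hhbarUq]; exact div_nonneg (by exact_mod_cast hU0) hq0.le
  -- `Bn`
  set Bn : ℕ := sumsMean v q Uq q 0 0 0 0 with hBn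
  have hBspec : ∀ j, j ≤ q → ((j : ℤ) * Uq - (q : ℤ) * Uv v j).toNat ≤ Bn := by
    have := sumsMean_spec v q Uq q 0 0 (fun j hj ↦ by rw [show j = 0 by omega]; simp [Uv])
    simpa [Sv, Uv] using this
  have hU : ∀ N, N < q → -((Bn : ℝ) / q) ≤ (∑ k ∈ range N, partialSum χ (k + 1)).re - N * hbar := by
    intro N hN
    rw [re_sum_partialSum_eq_Uv' hv, hhbarUq]
    have h1 := hBspec N hN.le
    have h2 : (N : ℤ) * Uq - (q : ℤ) * Uv v N ≤ (((N : ℤ) * Uq - (q : ℤ) * Uv v N).toNat : ℤ) :=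
      Int.self_le_toNat _
    have h3 : (N : ℤ) * Uq - (q : ℤ) * Uv v N ≤ (Bn : ℤ) := by omega
    have h4 : ((N : ℝ)) * Uq - (q : ℝ) * (Uv v N : ℝ) ≤ (Bn : ℝ) := by exact_mod_cast h3
    have key : (N : ℝ) * ((Uq : ℝ) / q) - (Bn : ℝ) / q ≤ (Uv v N : ℝ) := by
      rw [show (N : ℝ) * ((Uq : ℝ) / q) - (Bn : ℝ) / q = ((N : ℝ) * Uq - Bn) / q by ring,
        div_le_iff₀ hq0]
      nlinarith
    linarith
  -- `r`
  have hrq : isqrtSucc N₀ * isqrtSucc N₀ ≤ N₀ + 1 := by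
    have := (bisect_spec'' (fun r ↦ decide (r * r ≤ N₀ + 1)) (N₀ + 2) 0 (N₀ + 2) (by simp)
      (by simp only [decide_eq_false_iff_not, not_le]; nlinarith)).1
    simpa [isqrtSucc] using this
  set r := isqrtSucc N₀ with hrdef
  have hχ1 : χ ≠ 1 := SelbergDirichlet.ne_one_of_isPrimitive (by omega) hprim
  refine lfunction_ne_zero_of_truncation_mean χ hprim hχ1 hq7 hK (B := (Bn : ℝ) / q) (by positivity) hU hr hrq
    fun σ hσ1 hσ2 ↦ ?_
  -- choose the cell
  obtain ⟨j, hjJ, u, hu0, huh, hσ⟩ := exists_cell hJ1 hσ1 hσ2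
  set s₀ : ℝ := ((J + j : ℕ) : ℝ) / ((2 * J : ℕ) : ℝ) with hs₀
  have hinit : ∀ j', j' < J → (List.replicate J ((0 : ℤ), (0 : ℕ)))[j']? =
      some (aSpec v J P j' 0, dSpec v N₀ J P j' 0) := fun j' hj' ↦ by
    rw [List.getElem?_replicate, if_pos hj']; rfl
  have hget := loop_getElem? v N₀ J P N₀ 0 _ hinit j hjJ
  simp only [zero_add] at hget
  set e : ℕ := (enc (N₀ + 1) J P (J + j + 1)).1 with hedef
  have hgete : ((List.range J).map (fun j ↦ (enc (N₀ + 1) J P (J + j + 1)).1))[j]? = some e := by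
    rw [List.getElem?_map, List.getElem?_range hjJ]; rfl
  have hzip : ((loop v N₀ J P N₀ 0 (List.replicate J ((0 : ℤ), (0 : ℕ)))).zip
      ((List.range J).map (fun j ↦ (enc (N₀ + 1) J P (J + j + 1)).1)))[j]? =
      some ((aSpec v J P j N₀, dSpec v N₀ J P j N₀), e) :=
    List.getElem?_zip_eq_some.mpr ⟨hget, hgete⟩
  have hineq := hcells _ (List.mem_of_getElem? hzip)
  simp only at hineq
  set a : ℤ := aSpec v J P j N₀ with hadef
  set d : ℕ := dSpec v N₀ J P j N₀ with hddef
  set ρ : ℕ := (rootEnc N₀ (2 * J) P).1 with hρdef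
  set A : ℝ := ∑ n ∈ range N₀, (v (n + 1) : ℝ) * ((n + 1 : ℕ) : ℝ) ^ (-s₀) with hAdef
  set D : ℝ := ∑ i ∈ range (N₀ - 1), max 0 (-(∑ n ∈ range (i + 1), (v (n + 1) : ℝ) *
      ((n + 1 : ℕ) : ℝ) ^ (-s₀))) / ((i + 1 : ℕ) : ℝ) with hDdef
  set qu : ℝ := ((N₀ : ℕ) : ℝ) ^ (-u) with hqu
  set E : ℝ := ((N₀ + 1 : ℕ) : ℝ) ^ (-σ) with hE
  have hq0' : (0 : ℝ) < N₀ := by exact_mod_cast (show 0 < N₀ by omega)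
  have h2P : (0 : ℝ) < 2 ^ P := by positivity
  set T : ℤ := (if 0 ≤ a then a * ρ else a * 2 ^ P) with hT
  have h1 : (a : ℝ) ≤ 2 ^ P * A := aSpec_le v J P hJ1 hv3 j N₀
  have h2 : (2 ^ P : ℝ) * 2 ^ P * D ≤ d := by
    have := dSpec_ge v N₀ J P hJ1 hv3 j N₀
    rwa [show min N₀ (N₀ - 1) = N₀ - 1 by omega] at this
  have h3 : (ρ : ℝ) ≤ 2 ^ P * qu := by
    have hρ := (rootEnc_spec P (show 1 ≤ N₀ by omega) (show 1 ≤ 2 * J by omega)).1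
    refine hρ.trans (mul_le_mul_of_nonneg_left ?_ h2P.le)
    rw [hqu]
    exact Real.rpow_le_rpow_of_exponent_le (by exact_mod_cast (show 1 ≤ N₀ by omega)) (neg_le_neg huh)
  have hqu0 : 0 ≤ qu := (Real.rpow_pos_of_pos hq0' _).le
  -- the drift enclosure: `e ≤ 2^P (N₀+1)^{-s_{j+1}} ≤ 2^P E`
  have he : (e : ℝ) ≤ 2 ^ P * E := by
    have h := (enc_spec P (J + j + 1) (show 1 ≤ N₀ + 1 by omega) hJ1).1
    refine h.trans (mul_le_mul_of_nonneg_left ?_ h2P.le)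
    rw [hE]
    refine Real.rpow_le_rpow_of_exponent_le (by exact_mod_cast (show 1 ≤ N₀ + 1 by omega)) ?_
    rw [hσ, hs₀, neg_le_neg_iff]
    have hJ0 : (0 : ℝ) < ((2 * J : ℕ) : ℝ) := by positivity
    calc ((J + j : ℕ) : ℝ) / ((2 * J : ℕ) : ℝ) + u ≤ ((J + j : ℕ) : ℝ) / ((2 * J : ℕ) : ℝ) + 1 / ((2 * J : ℕ) : ℝ) := by
          linarith
      _ = ((J + j + 1 : ℕ) : ℝ) / ((2 * J : ℕ) : ℝ) := by rw [← add_div]; push_cast; ring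
  have hE0 : 0 ≤ E := (Real.rpow_pos_of_pos (by positivity) _).le
  -- the integer inequality over `ℝ`
  have h4 : (2 * J * (2 ^ P * 2 ^ P) * Bn + 2 * q * r * (N₀ + 1) * d : ℝ) <
      2 * (2 * J) * q * r * (N₀ + 1) * T + 2 * (2 * J) * r * (N₀ + 1) * 2 ^ P * Uq * e := by
    have := hineq
    push_cast at this
    exact_mod_cast this
  have hqu1 : qu ≤ 1 := by
    rw [hqu]
    exact Real.rpow_le_one_of_one_le_of_nonpos (by exact_mod_cast (show 1 ≤ N₀ by omega)) (by linarith)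
  have h5 : (T : ℝ) ≤ 2 ^ P * A * (2 ^ P * qu) := by
    by_cases ha0 : 0 ≤ a
    · rw [hT, if_pos ha0]
      have ha0' : (0 : ℝ) ≤ a := by exact_mod_cast ha0
      push_cast
      exact mul_le_mul h1 h3 (Nat.cast_nonneg _) (le_trans ha0' h1)
    · rw [hT, if_neg ha0]
      push_cast
      have ha' : (a : ℝ) < 0 := by exact_mod_cast (not_le.mp ha0)
      -- `a 2^P ≤ 4^P A qu` iff `a/2^P ≤ A qu`
      have hAq : (a : ℝ) / 2 ^ P ≤ A * qu := by
        have hA : (a : ℝ) / 2 ^ P ≤ A := by rw [div_le_iff₀ h2P]; linarith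
        by_cases hA0 : 0 ≤ A
        · exact le_trans (by
            have : (a : ℝ) / 2 ^ P < 0 := div_neg_of_neg_of_pos ha' h2P
            linarith) (mul_nonneg hA0 hqu0)
        · have hAneg : A < 0 := not_le.mp hA0
          calc (a : ℝ) / 2 ^ P ≤ A := hA
            _ = A * 1 := (mul_one A).symm
            _ ≤ A * qu := mul_le_mul_of_nonpos_left hqu1 hAneg.le
      have : (a : ℝ) * 2 ^ P = 2 ^ P * ((a : ℝ) / 2 ^ P) * 2 ^ P := by field_simp
      rw [this]
      have : 2 ^ P * A * (2 ^ P * qu) = 2 ^ P * (A * qu) * 2 ^ P := by ring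
      rw [this]
      exact mul_le_mul_of_nonneg_right (mul_le_mul_of_nonneg_left hAq h2P.le) h2P.le
  have hUq0 : (0 : ℝ) ≤ Uq := by exact_mod_cast hU0
  have h5e : (Uq : ℝ) * e ≤ Uq * (2 ^ P * E) := mul_le_mul_of_nonneg_left he hUq0
  have hcell := LTruncation.cell_bound (fun n ↦ (v (n + 1) : ℝ)) N₀ s₀ hu0 huh
  have hP : ∑ n ∈ range N₀, (χ ((n + 1 : ℕ) : ZMod q)).re * ((n + 1 : ℕ) : ℝ) ^ (-σ) =
      ∑ n ∈ range N₀, (v (n + 1) : ℝ) * ((n + 1 : ℕ) : ℝ) ^ (-(s₀ + u)) := by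
    refine Finset.sum_congr rfl fun n _ ↦ ?_
    rw [hv, hσ]
  rw [hP, re_sum_partialSum_eq_Uv' hv q, ← hUq]
  -- goal: Bn/q/(2r(N₀+1)) < Σ + (Uq/q)·E ; we show Bn/q/(2r(N₀+1)) + D/(2J) − (Uq/q)E < A qu − D/(2J) ≤ cell
  have hr0 : (0 : ℝ) < r := by exact_mod_cast hr
  have hJ0 : (0 : ℝ) < J := by exact_mod_cast hJ1
  set Kc : ℝ := 2 * (2 * J) * q * r * (N₀ + 1) with hKc
  have hK0 : 0 < Kc := by rw [hKc]; positivity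
  have hmain : (Bn : ℝ) * (2 * J) + D * (2 * q * r * (N₀ + 1)) <
      A * qu * Kc + (Uq : ℝ) * E * (2 * (2 * J) * r * (N₀ + 1)) := by
    have h6 : (2 * (2 * J) * q * r * (N₀ + 1) : ℝ) * T ≤
        (2 * (2 * J) * q * r * (N₀ + 1)) * (2 ^ P * A * (2 ^ P * qu)) :=
      mul_le_mul_of_nonneg_left h5 (by positivity)
    have h7 : (2 * q * r * (N₀ + 1) : ℝ) * (2 ^ P * 2 ^ P * D) ≤ (2 * q * r * (N₀ + 1)) * d :=
      mul_le_mul_of_nonneg_left h2 (by positivity)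
    have h7e : (2 * (2 * J) * r * (N₀ + 1) * 2 ^ P : ℝ) * (Uq * e) ≤
        (2 * (2 * J) * r * (N₀ + 1) * 2 ^ P) * (Uq * (2 ^ P * E)) :=
      mul_le_mul_of_nonneg_left h5e (by positivity)
    have h8 : (2 : ℝ) ^ P * 2 ^ P * ((Bn : ℝ) * (2 * J) + D * (2 * q * r * (N₀ + 1))) <
        2 ^ P * 2 ^ P * (A * qu * Kc + (Uq : ℝ) * E * (2 * (2 * J) * r * (N₀ + 1))) := by
      rw [hKc]; linarith
    exact lt_of_mul_lt_mul_left h8 (by positivity)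
  have e1 : ((Bn : ℝ) / q) / (2 * r * (N₀ + 1 : ℕ)) = (Bn : ℝ) * (2 * J) / Kc := by
    rw [hKc]; push_cast; field_simp
  have e2 : 1 / ((2 * J : ℕ) : ℝ) * D = D * (2 * q * r * (N₀ + 1)) / Kc := by
    rw [hKc]; push_cast; field_simp
  have e3 : (Uq : ℝ) / q * E = (Uq : ℝ) * E * (2 * (2 * J) * r * (N₀ + 1)) / Kc := by
    rw [hKc]; field_simp
  have hcell' : A * qu - 1 / ((2 * J : ℕ) : ℝ) * D + (Uq : ℝ) / q * E ≤
      (∑ n ∈ range N₀, (v (n + 1) : ℝ) * ((n + 1 : ℕ) : ℝ) ^ (-(s₀ + u))) + (Uq : ℝ) / q * E := by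
    have : ((N₀ : ℕ) : ℝ) = (K * q : ℕ) := by rw [hN₀]
    linarith [hcell]
  refine lt_of_lt_of_le ?_ hcell'
  rw [e1, e2, e3, ← sub_pos]
  have : A * qu - D * (2 * ↑q * ↑r * (↑N₀ + 1)) / Kc + ↑Uq * E * (2 * (2 * ↑J) * ↑r * (↑N₀ + 1)) / Kc -
      ↑Bn * (2 * ↑J) / Kc = (A * qu * Kc + ↑Uq * E * (2 * (2 * ↑J) * ↑r * (↑N₀ + 1)) -
        (↑Bn * (2 * ↑J) + D * (2 * ↑q * ↑r * (↑N₀ + 1)))) / Kc := by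
    field_simp
    ring
  rw [this]
  exact div_pos (by linarith) hK0

end Soundness

/-! ## Per-conductor wrappers, ODD characters (parity test or mean certificate) -/

section Wrappers

/-- **Odd characters of odd conductor `q`**, mean certificate. [cite: Chua2005RealZeros, §2.2 ALGO 1] -/
theorem good_odd_of_odd_mean {q : ℕ} [NeZero q] (hq2 : q % 2 = 1) (hq1 : 1 < q) (K J P : ℕ)
    (h : valOdd q (q - 1) = 1 ∨ certMeanOK (valOdd q) q K J P = true) :
    ∀ χ : DirichletCharacter ℂ q, χ.IsQuadratic → χ.IsPrimitive → χ.Odd →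
      ∀ σ : ℝ, 0 < σ → σ < 1 → χ.LFunction σ ≠ 0 := by
  intro χ hquad hprim hodd σ hσ0 hσ1
  have hv := re_apply_eq_valOdd (Nat.odd_iff.mpr hq2) hq1 hprim hquad
  rcases h with hpar | hcert
  · exact (OddSmallModuliII.not_odd_of_val _ hv hpar hodd).elim
  · exact lfunction_ne_zero_of_certMeanOK hprim hquad hv hcert σ hσ0 hσ1

/-- **Odd characters of conductor `4m`**, mean certificate. [cite: Chua2005RealZeros, §2.2 ALGO 1] -/
theorem good_odd_of_four_mean {q : ℕ} [NeZero q] (hq8 : q % 8 = 4) (hq1 : 4 < q) (K J P : ℕ)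
    (h : valFour (q / 4) (q - 1) = 1 ∨ certMeanOK (valFour (q / 4)) q K J P = true) :
    ∀ χ : DirichletCharacter ℂ q, χ.IsQuadratic → χ.IsPrimitive → χ.Odd →
      ∀ σ : ℝ, 0 < σ → σ < 1 → χ.LFunction σ ≠ 0 := by
  obtain ⟨m, rfl⟩ : ∃ m, q = 4 * m := ⟨q / 4, by omega⟩
  haveI : NeZero m := ⟨by omega⟩
  rw [Nat.mul_div_cancel_left m (by norm_num : 0 < 4)] at h
  intro χ hquad hprim hodd σ hσ0 hσ1
  have hv := re_apply_eq_valFour (m := m) (Nat.odd_iff.mpr (by omega)) (by omega) hprim hquad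
  rcases h with hpar | hcert
  · exact (OddSmallModuliII.not_odd_of_val _ hv hpar hodd).elim
  · exact lfunction_ne_zero_of_certMeanOK hprim hquad hv hcert σ hσ0 hσ1

/-- **Odd characters of conductor `8m`**, mean certificate, both value patterns.
[cite: Chua2005RealZeros, §2.2 ALGO 1] -/
theorem good_odd_of_eight_mean {q : ℕ} [NeZero q] (hq16 : q % 16 = 8) (hq1 : 8 < q) (K J P : ℕ)
    (hA : valEightA (q / 8) (q - 1) = 1 ∨ certMeanOK (valEightA (q / 8)) q K J P = true)
    (hB : valEightB (q / 8) (q - 1) = 1 ∨ certMeanOK (valEightB (q / 8)) q K J P = true) :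
    ∀ χ : DirichletCharacter ℂ q, χ.IsQuadratic → χ.IsPrimitive → χ.Odd →
      ∀ σ : ℝ, 0 < σ → σ < 1 → χ.LFunction σ ≠ 0 := by
  obtain ⟨m, rfl⟩ : ∃ m, q = 8 * m := ⟨q / 8, by omega⟩
  haveI : NeZero m := ⟨by omega⟩
  rw [Nat.mul_div_cancel_left m (by norm_num : 0 < 8)] at hA hB
  intro χ hquad hprim hodd σ hσ0 hσ1
  rcases re_apply_eq_valEight (m := m) (Nat.odd_iff.mpr (by omega)) (by omega) hprim hquad with hv | hv
  · rcases hA with hpar | hcert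
    · exact (OddSmallModuliII.not_odd_of_val _ hv hpar hodd).elim
    · exact lfunction_ne_zero_of_certMeanOK hprim hquad hv hcert σ hσ0 hσ1
  · rcases hB with hpar | hcert
    · exact (OddSmallModuliII.not_odd_of_val _ hv hpar hodd).elim
    · exact lfunction_ne_zero_of_certMeanOK hprim hquad hv hcert σ hσ0 hσ1

end Wrappers

end LTruncationCert

end Literature.NumberTheory.LFunctions
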